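import Literature.Probability.Percolation.GladkovThreeClusterDichotomyProofs
import HarnessLib

/-!
# `NoHeavyLowerTail` (stmt-CriticalPhenomena-4575) — three-point MIDDLE MASS: the 'exactly one pair' level carries at least half of
# `min(all joined, all separated)` (corollary of Gladkov–Zimin's three-point inequality)

Support file (prover seat `prim-a5-assembly-1`, `--supports stmt-CriticalPhenomena-4575`; memo `run/shared/lean/prim/prim-a5/ASSEMBLY.md` §11).
No definitions, no sorries, no named facts.

For bond percolation `μ = prodBernoulli w` on a finite vertex type and three vertices `a, b, c` write
`t = μ(a ↔ b ↔ c)` (all joined), `q = μ(a ↮ b, a ↮ c, b ↮ c)` (pairwise separated) and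
`u = μ(ab|c) + μ(ac|b) + μ(bc|a)` (exactly one pair joined).  The Gladkov–Zimin three-point inequality
[GladkovZimin2024, Thm. 4.6] (tree: `Literature.Probability.Percolation.gladkovZimin2024_threePoint_prodBernoulli`) says
`μ(a ↮ b, a ↮ c) · μ(a ↔ b ∨ a ↔ c) ≤ u`.  Since `q ≤ μ(a ↮ b, a ↮ c) =: I`, `t ≤ μ(a ↔ b ∨ a ↔ c) = 1 − I` and
`I(1 − I) ≥ ½·min(I, 1 − I)`, this gives the MIDDLE-MASS bound

  `min(t, q) ≤ 2u`      (`min_allJoined_allSep_le_two_mul_middle`).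

WHY IT IS HERE.  The census-clean four-point row `Z(3,2)` (`OneCutFive.ZeroOneThree`, which implies the glued half of the `|A| = 5`
one-cut bound) has exact PSEUDO-laws over every quadratic cone tried (two-set BHK, Harris, SHK3⁺/AG — ttrl cp-wf3b z/48), all of the shape
'the three relays are all joined or all separated, never exactly one pair'; such laws have `u ≈ 0 < min(t,q)` and are killed by exactly this
bound (z/48: `u = 3/48`, `min(t,q) = 18/48`).  The census suggests the sharp constant is `u ≥ c·min(t,q)` with `c ≈ 1.55` (conjecture MID, not
proved); the factor `½` here is what the printed inequality gives.
[cite: GladkovZimin2024, Thm. 4.6 (three-point inequality; tree `gladkovZimin2024_threePoint_prodBernoulli`)]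
-/

noncomputable section

namespace Summit.CriticalPhenomena.PercolationContinuityZ3.Theorems

open MeasureTheory Set Literature.Probability.LatticeModels Literature.Probability.Percolation

namespace ThreePointMiddleMass

variable {V : Type*} [Fintype V]

/-- **Middle mass.**  For every finite weighted graph and vertices `a, b, c`:
`min(μ(all three joined), μ(all three separated)) ≤ 2·μ(exactly one pair joined)`.
[cite: GladkovZimin2024, Thm. 4.6 (corollary derived here)] -/
theorem min_allJoined_allSep_le_two_mul_middle (w : Sym2 V → unitInterval) (a b c : V) :
    min ((prodBernoulli w).real (openConn a b ∩ openConn a c))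
        ((prodBernoulli w).real ((openConn a b)ᶜ ∩ (openConn a c)ᶜ ∩ (openConn b c)ᶜ)) ≤
      2 * ((prodBernoulli w).real (openConn a b ∩ (openConn a c)ᶜ) +
        (prodBernoulli w).real (openConn a c ∩ (openConn a b)ᶜ) +
          (prodBernoulli w).real ((openConn a b)ᶜ ∩ (openConn a c)ᶜ ∩ openConn b c)) := by
  classical
  set μ := prodBernoulli w with hμ
  set I := μ.real ((openConn a b)ᶜ ∩ (openConn a c)ᶜ) with hI
  set J := μ.real (openConn a b ∪ openConn a c) with hJ
  set t := μ.real (openConn a b ∩ openConn a c) with ht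
  set q := μ.real ((openConn a b)ᶜ ∩ (openConn a c)ᶜ ∩ (openConn b c)ᶜ) with hq
  set u := μ.real (openConn a b ∩ (openConn a c)ᶜ) + μ.real (openConn a c ∩ (openConn a b)ᶜ) +
    μ.real ((openConn a b)ᶜ ∩ (openConn a c)ᶜ ∩ openConn b c) with hu
  -- Gladkov–Zimin: `I · J ≤ u`
  have hGZ : I * J ≤ u := gladkovZimin2024_threePoint_prodBernoulli w a b c
  -- `I + J = 1`
  have hcompl : ((openConn a b ∪ openConn a c : Set (BondConfig V)))ᶜ = (openConn a b)ᶜ ∩ (openConn a c)ᶜ :=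
    Set.compl_union _ _
  have hIJ : J + I = 1 := by
    rw [hJ, hI, ← hcompl, measureReal_add_measureReal_compl MeasurableSet.of_discrete, probReal_univ]
  -- `q ≤ I`, `t ≤ J`
  have hqI : q ≤ I := measureReal_mono (fun ω hω => hω.1)
  have htJ : t ≤ J := measureReal_mono (fun ω hω => Or.inl hω.1)
  have hI0 : 0 ≤ I := measureReal_nonneg
  have hJ0 : 0 ≤ J := measureReal_nonneg
  by_cases hhalf : I ≤ 1 / 2
  · -- `I · J = I (1 - I) ≥ I / 2 ≥ q / 2`
    have hJge : 1 / 2 ≤ J := by linarith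
    have h1 : I / 2 ≤ I * J := by nlinarith
    calc min t q ≤ q := min_le_right _ _
      _ ≤ 2 * u := by linarith
  · have hIge : 1 / 2 ≤ I := by linarith
    have h1 : J / 2 ≤ I * J := by nlinarith
    calc min t q ≤ t := min_le_left _ _
      _ ≤ 2 * u := by linarith

/-- The same bound with the three 'exactly one pair' cells written symmetrically (`ab|c`, `ac|b`, `bc|a` as
`{a↔b}∩{b↮c}`, `{a↔c}∩{b↮c}`, `{b↔c}∩{a↮b}`). [cite: GladkovZimin2024, Thm. 4.6 (corollary derived here)] -/
theorem min_allJoined_allSep_le_two_mul_onePair (w : Sym2 V → unitInterval) (a b c : V) :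
    min ((prodBernoulli w).real (openConn a b ∩ openConn a c))
        ((prodBernoulli w).real ((openConn a b)ᶜ ∩ (openConn a c)ᶜ ∩ (openConn b c)ᶜ)) ≤
      2 * ((prodBernoulli w).real (openConn a b ∩ (openConn b c)ᶜ) +
        (prodBernoulli w).real (openConn a c ∩ (openConn b c)ᶜ) +
          (prodBernoulli w).real (openConn b c ∩ (openConn a b)ᶜ)) := by
  have hmem : ∀ (ω : BondConfig V) (x y : V), ω ∈ (openConn x y : Set (BondConfig V)) ↔ (openGraph ω).Reachable x y :=
    fun _ _ _ => Iff.rfl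
  -- the three cells coincide with those of the previous theorem (transitivity of `↔`)
  have e1 : (openConn a b ∩ (openConn a c)ᶜ : Set (BondConfig V)) = openConn a b ∩ (openConn b c)ᶜ := by
    ext ω; simp only [mem_inter_iff, mem_compl_iff, hmem]
    constructor
    · rintro ⟨h1, h2⟩; exact ⟨h1, fun h => h2 (h1.trans h)⟩
    · rintro ⟨h1, h2⟩; exact ⟨h1, fun h => h2 (h1.symm.trans h)⟩
  have e2 : (openConn a c ∩ (openConn a b)ᶜ : Set (BondConfig V)) = openConn a c ∩ (openConn b c)ᶜ := by
    ext ω; simp only [mem_inter_iff, mem_compl_iff, hmem]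
    constructor
    · rintro ⟨h1, h2⟩; exact ⟨h1, fun h => h2 (h1.trans h.symm)⟩
    · rintro ⟨h1, h2⟩; exact ⟨h1, fun h => h2 (h.symm.trans h1)⟩
  have e3 : ((openConn a b)ᶜ ∩ (openConn a c)ᶜ ∩ openConn b c : Set (BondConfig V)) = openConn b c ∩ (openConn a b)ᶜ := by
    ext ω; simp only [mem_inter_iff, mem_compl_iff, hmem]
    constructor
    · rintro ⟨⟨h1, _⟩, h3⟩; exact ⟨h3, h1⟩
    · rintro ⟨h3, h1⟩; exact ⟨⟨h1, fun h => h1 (h.trans h3.symm)⟩, h3⟩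
  have h := min_allJoined_allSep_le_two_mul_middle w a b c
  rw [e1, e2, e3] at h
  exact h

end ThreePointMiddleMass

end Summit.CriticalPhenomena.PercolationContinuityZ3.Theorems
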